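import Summits.QuantumFields.YangMills.Theorems.LuscherReductionOneSiteLevelsKacDefs
import Summits.QuantumFields.YangMills.Theorems.LuscherReductionOneSiteLevelsKacFlatten
import Literature.Analysis.OperatorTheory.YangMillsMatrixModelLevels
import Literature.Analysis.OperatorTheory.YangMillsMatrixModelDiscreteness
import Literature.Analysis.OperatorTheory.YangMillsMatrixModelCutoffEnergy

/-!
# Lüscher reduction, `OneSiteLevels` flat lane (layer III): the III.11 ASSEMBLY as a sorry-free composition theorem

**slotsA = critic's repair (stub-critic g4, STUB-PLAN rev 4 §7.5) of ideas-1 v5 `KacFlatAssembly_landable.lean` 8f46e676:**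
(1) `HighModesAt` concludes `… − A·D ≤ kacForm t r` for SOME `A ≥ 0` (was `A = 1`, which presumes the EXACT Gaussian
smoothing coefficient; the landed III.3 `integral_potential_mul_heatSmooth_sq_le` (p486293) has `192 s‖x‖²`, i.e. `A = 96` at `s = t/2`);
the assembly absorbs `A` into `C := max C₈ 0 + C₉² + A·M`.  (2) `Integrable r` (resp. `Integrable u, v`) added as hypotheses of
`CrossTermBound`, `HighModesAt`, `KacFormAdd` so the slot provers can call the landed KacHeat lemmas (all take `Integrable g`) verbatim;
the assembly discharges them (`integrable_of_bounded_of_support`, p2's KacFlatten l.121, and `eigen_integrable`).  Nothing else changed.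

(Companion of ideas-1 v5 `STUB-IDEAS-stub_absUpperInnerAL1-1-FlatLane.lean` §6a–§6c, namespace moved to the tree's
`…Theorems.FemtoTransferGap.KacFlatAssembly`; 0 `sorry`; imports tree modules only — LANDABLE AS IS by a prover as
`Theorems/LuscherReductionOneSiteLevelsKacFlatAssembly.lean --supports stmt-QuantumFields-20007 --as helper`.)

`flatKac_of_slots` proves the registered flat-lane stub's statement `(∀ k, LuscherHamiltonianEigenfunctions k) → ∀ k, FlatKacFormBound k`
(skeleton v12 `Stmt.stub_flatKacAL1`; STUB-PLAN rev 3 row III.11 `flatKac_of_AL1`) from EIGHT Prop-valued SLOTS = the direct leaves of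
the assembly, ∀-closed over the AL1 family: three analytic ones — `SpanLowerBound` (III.8), `CrossTermBound` (III.9), `HighModesBound`
(III.10, threshold-agnostic) — and five bookkeeping ones — `MomentBound` (A5), `KacFormAdd` (A4), `ProjectionSplit` (A3),
`SpanWeightIntegrable` (A2h), `BallWeightIntegrable` (A6a).  Once the flat seat has the eight slots as theorems,
`theorem flatKac_of_AL1 := KacFlatAssembly.flatKac_of_slots h8 h9 h10 hM hadd hπ hW hB` closes `stub_flatKacAL1` by name.

Proof of the composition: index `m` above the slot threshold `Λ(k, κ)` (`tendsto_physLevel_atTop`) · AL1 at the ONE index `m` ·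
`C := max C₈ 0 + C₉² + A·M`, `t₀ := min t₁₀ 1`, constraints `fs i := f_i (i < k)` · split `g = F + r`, `c_j = ⟨g,f_j⟩` · `c_j = 0 (j < k)`
⇒ `Σ c_j²E_j ≥ E_k‖F‖²` · III.8 on `F` · III.9 + absorption `2C₉√t‖F‖‖r‖ ≤ ‖r‖² + C₉²t‖F‖²` · III.10 on `r` with slack `D = tM‖c‖²` ·
A4 + A3 · `nlinarith`.  HONEST FRAMING: femto rung R2b1 of `LuscherReduction`, AL1-conditional; nothing here is a mass-gap statement.
-/

noncomputable section

open MeasureTheory Filter Topology Real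
open Literature.MathematicalPhysics.QuantumFieldTheory
open Literature.MathematicalPhysics.QuantumLattice
open Literature.Analysis.OperatorTheory.YMMatrixModel

namespace Summit.QuantumFields.YangMills.Theorems.FemtoTransferGap

namespace KacFlatAssembly

/-! ### Plumbing (PROVED) -/

variable {m : ℕ} {f : Fin (m + 1) → ZM → ℝ}

/-- **A1 (S, PROVED)** index above ANY threshold: the levels go to infinity (tree `tendsto_physLevel_atTop`, PROVED, Simon 1983
Cor. 4), so above `Λ` there is a level `E_{m+1} = physLevel (m+2)` with `m + 1 ≥ k`.  (Threshold-agnostic: whatever margin the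
high-modes row needs — `E_k + κ² + 3`, or `E_k + C₁κ² + C₂` with sloppy smoothing constants — is absorbed here at no cost.) -/
theorem exists_index_above (k : ℕ) (Λ : ℝ) : ∃ m : ℕ, k ≤ m + 1 ∧ Λ ≤ physLevel (m + 2) := by
  obtain ⟨N, hN⟩ := tendsto_atTop_atTop.1 tendsto_physLevel_atTop Λ
  exact ⟨N + k, by omega, hN _ (by omega)⟩

/-- **A1′ (S, PROVED)** the STUB-PLAN III.10 margin `E_k + κ² + 3`. -/
theorem exists_gap_index (k : ℕ) (κ : ℝ) :
    ∃ m : ℕ, k ≤ m + 1 ∧ physLevel (k + 1) + κ ^ 2 + 3 ≤ physLevel (m + 2) :=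
  exists_index_above k _

/-- **A2a (S, PROVED)** eigenfunctions are continuous. -/
theorem eigen_continuous (hf : IsEigenFamily m f) (j : Fin (m + 1)) : Continuous (f j) :=
  (hf.1 j 0).continuous

/-- **A2b (S, PROVED)** eigenfunctions are measurable. -/
theorem eigen_measurable (hf : IsEigenFamily m f) (j : Fin (m + 1)) : Measurable (f j) :=
  (eigen_continuous hf j).measurable

/-- **A2c (S, PROVED)** eigenfunctions are bounded (`ExpDecay₂.abs_le`). -/
theorem eigen_bounded (hf : IsEigenFamily m f) (j : Fin (m + 1)) : ∃ M : ℝ, ∀ x, |f j x| ≤ M :=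
  (hf.2.2.2.2 j).abs_le

/-- **A2d (S, PROVED)** eigenfunctions are integrable (`ExpDecay₂` + tree `integrable_exp_neg_norm`). -/
theorem eigen_integrable (hf : IsEigenFamily m f) (j : Fin (m + 1)) : Integrable (f j) := by
  obtain ⟨C, hC⟩ := hf.2.2.2.2 j
  refine Integrable.mono' (integrable_exp_neg_norm.const_mul C) (eigen_continuous hf j).aestronglyMeasurable
    (ae_of_all _ fun x => ?_)
  rw [Real.norm_eq_abs]
  exact (hC x).1

/-- **A2e (S, PROVED)** spans are measurable. -/
theorem span_measurable (hf : IsEigenFamily m f) (c : Fin (m + 1) → ℝ) :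
    Measurable (fun x => ∑ j, c j * f j x) :=
  Finset.measurable_sum _ fun j _ => (eigen_measurable hf j).const_mul (c j)

/-- **A2f (S, PROVED)** spans are bounded. -/
theorem span_bounded (hf : IsEigenFamily m f) (c : Fin (m + 1) → ℝ) :
    ∃ M : ℝ, ∀ x, |∑ j, c j * f j x| ≤ M := by
  choose M hM using fun j => eigen_bounded hf j
  refine ⟨∑ j, |c j| * M j, fun x => (Finset.abs_sum_le_sum_abs _ _).trans (Finset.sum_le_sum fun j _ => ?_)⟩
  rw [abs_mul]
  exact mul_le_mul_of_nonneg_left (hM j x) (abs_nonneg _)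

/-- **A2g (S, PROVED)** spans are colour-invariant. -/
theorem span_isGaugeInv (hf : IsEigenFamily m f) (c : Fin (m + 1) → ℝ) :
    IsGaugeInv (fun x => ∑ j, c j * f j x) := fun R hR x => by
  simp only [hf.2.1 _ R hR x]

/-- **A6b (S, PROVED)** dropping the weight. -/
theorem sq_integrable_of_weight {w : ZM → ℝ} (hwm : Measurable w) (hw : Integrable (fun x => (1 + ‖x‖ ^ 4) * w x ^ 2)) :
    Integrable (fun x => w x ^ 2) := by
  refine Integrable.mono' hw ((hwm.pow_const 2).aestronglyMeasurable) (ae_of_all _ fun x => ?_)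
  rw [Real.norm_eq_abs, abs_of_nonneg (sq_nonneg _)]
  have h1 : (1 : ℝ) ≤ 1 + ‖x‖ ^ 4 := le_add_of_nonneg_right (by positivity)
  nlinarith [sq_nonneg (w x)]

/-- **A6c (S, PROVED)** weighted square-integrability passes to differences (`(u−v)² ≤ 2u² + 2v²`). -/
theorem weight_integrable_sub {u v : ZM → ℝ} (hum : Measurable u) (hvm : Measurable v)
    (hu : Integrable (fun x => (1 + ‖x‖ ^ 4) * u x ^ 2)) (hv : Integrable (fun x => (1 + ‖x‖ ^ 4) * v x ^ 2)) :
    Integrable (fun x => (1 + ‖x‖ ^ 4) * (u x - v x) ^ 2) := by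
  have hw : Measurable fun x : ZM => (1 + ‖x‖ ^ 4) := measurable_const.add (measurable_norm.pow_const 4)
  refine Integrable.mono' ((hu.add hv).const_mul 2) ((hw.mul ((hum.sub hvm).pow_const 2)).aestronglyMeasurable)
    (ae_of_all _ fun x => ?_)
  have h0 : (0 : ℝ) ≤ 1 + ‖x‖ ^ 4 := by positivity
  rw [Real.norm_eq_abs, abs_of_nonneg (mul_nonneg h0 (sq_nonneg _))]
  simp only [Pi.add_apply]
  nlinarith [mul_nonneg h0 (sq_nonneg (u x + v x))]

/-! ### The eight SLOTS — the direct leaves of III.11 as Prop-valued statements (∀-closed over the family)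

Three analytic slots (STUB-PLAN rows III.8, III.9, III.10 — the flat seat's whole risk) and five bookkeeping slots (S/M).  The
high-modes slot is THRESHOLD-AGNOSTIC (`∃ Λ`): the margin `E_k + κ² + 3` of III.10, or any `E_k + C₁κ² + C₂` coming from sloppier
smoothing constants, fits — A1 `exists_index_above` absorbs it.  The cross-term slot asks only for the rate `√t` (an `O(t)` bound implies
it for `t ≤ 1`). -/

/-- SLOT III.8 (span lower bound, M): `kac_t(Σ c_j f_j) ≥ Σ c_j² E_j − C t Σ c_j²`, `C = C(m, family)`. [cite: SimonB1983DiscreteSpectrum, §3] [cite: ReedSimonIV1978, Thm. XIII.1–2] -/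
def SpanLowerBound : Prop :=
  ∀ (m : ℕ) (f : Fin (m + 1) → ZM → ℝ), IsEigenFamily m f → ∃ C : ℝ, ∀ t : ℝ, 0 < t → ∀ c : Fin (m + 1) → ℝ,
    (∑ j, c j ^ 2 * physLevel ((j : ℕ) + 1)) - C * t * ∑ j, c j ^ 2 ≤ kacForm t (fun x => ∑ j, c j * f j x)

/-- SLOT III.9 (cross term, S/M): `|kacBil_t(F, r)| ≤ C √t ‖F‖ ‖r‖` for `r ⊥ f_0 … f_m` bounded measurable square-integrable. [cite: SimonB1983DiscreteSpectrum, §3] [cite: ReedSimonIV1978, Thm. XIII.1–2] -/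
def CrossTermBound : Prop :=
  ∀ (m : ℕ) (f : Fin (m + 1) → ZM → ℝ), IsEigenFamily m f → ∃ C : ℝ, ∀ t : ℝ, 0 < t → t ≤ 1 →
    ∀ c : Fin (m + 1) → ℝ, ∀ r : ZM → ℝ, Measurable r → (∃ M : ℝ, ∀ x, |r x| ≤ M) → Integrable r →
      Integrable (fun x => r x ^ 2) → (∀ j, ∫ x, r x * f j x = 0) →
      |kacBil t (fun x => ∑ j, c j * f j x) r| ≤ C * Real.sqrt t * Real.sqrt (∑ j, c j ^ 2) * Real.sqrt (∫ x, r x ^ 2)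

/-- SLOT III.10 at `(k, κ)` with threshold `Λ` (high modes, M): for every AL1 family reaching above `Λ` (`Λ ≤ E_{m+1}`), remainders
`r = g − Σ c_j f_j ⊥ f_0 … f_m` of ball-supported bounded invariant `g` with moment `t∫‖x‖²r² ≤ κ²‖r‖² + D` have
`kac_t(r) ≥ (E_k + 1)‖r‖² − A·D` for `t ≤ t₀(k, κ, m, f)` and some `A = A(k, κ, m, f) ≥ 0` (slotsA).  (= the statement of `G3.kacForm_highModes_ge'` with its gap hypothesis
`E_k + κ² + 3 ≤ E_{m+1}` generalised to `Λ ≤ E_{m+1}`.) [cite: SimonB1983DiscreteSpectrum, §3] [cite: ReedSimonIV1978, Thm. XIII.1–2] -/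
def HighModesAt (k : ℕ) (κ Λ : ℝ) : Prop :=
  ∀ (m : ℕ) (f : Fin (m + 1) → ZM → ℝ), IsEigenFamily m f → Λ ≤ physLevel (m + 2) →
    ∃ t₀ : ℝ, 0 < t₀ ∧ ∃ A : ℝ, 0 ≤ A ∧ ∀ t : ℝ, 0 < t → t ≤ t₀ → ∀ r : ZM → ℝ, Measurable r → (∃ M : ℝ, ∀ x, |r x| ≤ M) →
      IsGaugeInv r → Integrable r →
      Integrable (fun x => (1 + ‖x‖ ^ 4) * r x ^ 2) → (∀ j, ∫ x, r x * f j x = 0) →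
      (∃ (c : Fin (m + 1) → ℝ) (g : ZM → ℝ) (R : ℝ), Measurable g ∧ (∃ M : ℝ, ∀ x, |g x| ≤ M) ∧ IsGaugeInv g ∧
        (∀ x, g x ≠ 0 → ‖x‖ ≤ R) ∧ ∀ x, r x = g x - ∑ j, c j * f j x) →
      ∀ D : ℝ, 0 ≤ D → t * ∫ x, ‖x‖ ^ 2 * r x ^ 2 ≤ κ ^ 2 * (∫ x, r x ^ 2) + D →
      (physLevel (k + 1) + 1) * (∫ x, r x ^ 2) - A * D ≤ kacForm t r

/-- SLOT III.10 (∀-closed): at every `(k, κ)` SOME threshold works. [cite: SimonB1983DiscreteSpectrum, §3] [cite: ReedSimonIV1978, Thm. XIII.1–2] -/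
def HighModesBound : Prop := ∀ (k : ℕ) (κ : ℝ), 0 < κ → ∃ Λ : ℝ, HighModesAt k κ Λ

/-- SLOT A5 (moment from support, S/M): `t∫‖x‖²(g − F)² ≤ κ²‖g − F‖² + t·M·Σ c_j²` for `g` supported in `‖x‖ ≤ κ/√t`. [cite: ReedSimonIV1978, §XIII.1] [folklore] -/
def MomentBound : Prop :=
  ∀ (m : ℕ) (f : Fin (m + 1) → ZM → ℝ), IsEigenFamily m f →
    ∃ M : ℝ, 0 ≤ M ∧ ∀ t : ℝ, 0 < t → ∀ κ : ℝ, 0 < κ → ∀ c : Fin (m + 1) → ℝ, ∀ g : ZM → ℝ, Measurable g →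
      (∃ B : ℝ, ∀ x, |g x| ≤ B) → (∀ x, g x ≠ 0 → ‖x‖ ≤ κ / Real.sqrt t) →
      t * ∫ x, ‖x‖ ^ 2 * (g x - ∑ j, c j * f j x) ^ 2 ≤
        κ ^ 2 * (∫ x, (g x - ∑ j, c j * f j x) ^ 2) + t * (M * ∑ j, c j ^ 2)

/-- SLOT A4 (bilinear expansion, M): `kac_t(u + v) = kac_t(u) + 2 kacBil_t(u, v) + kac_t(v)` on `L^∞ ∩ L²((1+‖x‖⁴)dx)`. [cite: ReedSimonIV1978, §XIII.1] [folklore] -/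
def KacFormAdd : Prop :=
  ∀ t : ℝ, 0 < t → ∀ u v : ZM → ℝ, Measurable u → Measurable v → (∃ M : ℝ, ∀ x, |u x| ≤ M) → (∃ M : ℝ, ∀ x, |v x| ≤ M) →
    Integrable u → Integrable v →
    Integrable (fun x => (1 + ‖x‖ ^ 4) * u x ^ 2) → Integrable (fun x => (1 + ‖x‖ ^ 4) * v x ^ 2) →
    kacForm t (fun x => u x + v x) = kacForm t u + 2 * kacBil t u v + kacForm t v

/-- SLOT A3 (orthogonal projection, S): with `c_j = ⟨g, f_j⟩`, the remainder is `⊥ f_j` and `‖g‖² = Σ c_j² + ‖g − Σ c_j f_j‖²`. [cite: ReedSimonIV1978, §XIII.1] [folklore] -/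
def ProjectionSplit : Prop :=
  ∀ (m : ℕ) (f : Fin (m + 1) → ZM → ℝ), IsEigenFamily m f → ∀ g : ZM → ℝ, Measurable g → (∃ M : ℝ, ∀ x, |g x| ≤ M) →
    (∀ j, ∫ x, (g x - ∑ i, (∫ y, g y * f i y) * f i x) * f j x = 0) ∧
    (Integrable (fun x => g x ^ 2) →
      ∫ x, g x ^ 2 = (∑ j, (∫ y, g y * f j y) ^ 2) + ∫ x, (g x - ∑ i, (∫ y, g y * f i y) * f i x) ^ 2)

/-- SLOT A2h (S): spans are in the weighted `L²`. [cite: ReedSimonIV1978, §XIII.1] [folklore] -/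
def SpanWeightIntegrable : Prop :=
  ∀ (m : ℕ) (f : Fin (m + 1) → ZM → ℝ), IsEigenFamily m f → ∀ c : Fin (m + 1) → ℝ,
    Integrable (fun x => (1 + ‖x‖ ^ 4) * (∑ j, c j * f j x) ^ 2)

/-- SLOT A6a (S): bounded measurable ball-supported functions are in the weighted `L²`. [cite: ReedSimonIV1978, §XIII.1] [folklore] -/
def BallWeightIntegrable : Prop :=
  ∀ g : ZM → ℝ, Measurable g → (∃ B : ℝ, ∀ x, |g x| ≤ B) → ∀ R : ℝ, (∀ x, g x ≠ 0 → ‖x‖ ≤ R) →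
    Integrable (fun x => (1 + ‖x‖ ^ 4) * g x ^ 2)

/-! ### THE ASSEMBLY — STUB-PLAN III.11 KERNEL-CHECKED as a sorry-free composition of the eight slots

`flatKac_of_slots` : slots + `∀ k, AL1 k` ⟹ `FlatKacFormBound k` — no `sorry` anywhere in its cone.  Proof: A1 index `m` above the
slot's threshold `Λ(k, κ)` · AL1 at the ONE index `m` (`isEigenFamily_of_AL1`) · constants `C := max C₈ 0 + C₉² + M`, `t₀ := min t₁₀ 1`,
constraints `fs i := f_i` (`i < k ≤ m+1`) · split `g = F + r`, `c_j = ⟨g, f_j⟩` · the `k` constraints kill `c_j (j < k)` so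
`Σ c_j² E_j ≥ E_k ‖F‖²` · III.8 on `F` · III.9 + the absorption `2C₉√t‖F‖‖r‖ ≤ ‖r‖² + C₉²t‖F‖²` (STUB-PLAN §2.5b (8)) in-line ·
III.10 on `r` with the A5 slack `D = t·M·‖c‖²` · A4 expansion + A3 Pythagoras · `nlinarith`. -/

/-- **III.11 (PROVED): the eight slots and AL1 give the flat Kac-form bound** (= v12 `Stmt.stub_flatKacAL1` pointwise in `k`,
with the leaves as hypotheses). -/
theorem flatKac_of_slots (h8 : SpanLowerBound) (h9 : CrossTermBound) (h10 : HighModesBound) (hM : MomentBound)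
    (hadd : KacFormAdd) (hπ : ProjectionSplit) (hW : SpanWeightIntegrable) (hB : BallWeightIntegrable)
    (hAL1 : ∀ k, LuscherHamiltonianEigenfunctions k) (k : ℕ) : FlatKacFormBound k := by
  intro κ hκ
  -- III.10's threshold at (k, κ), A1: an index above it, and the AL1 family at that single index
  obtain ⟨Λ, hHM⟩ := h10 k κ hκ
  obtain ⟨m, hkm, hgap⟩ := exists_index_above k Λ
  obtain ⟨f, hf⟩ := isEigenFamily_of_AL1 m (hAL1 m)
  -- the layer constants (III.8, III.9, III.10, A5)
  obtain ⟨C₈, h8⟩ := h8 m f hf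
  obtain ⟨C₉, h9⟩ := h9 m f hf
  obtain ⟨t₁₀, ht₁₀, A₁₀, hA₁₀, h10⟩ := hHM m f hf hgap
  obtain ⟨M, hM0, hmom⟩ := hM m f hf
  refine ⟨max C₈ 0 + C₉ ^ 2 + A₁₀ * M, min t₁₀ 1, lt_min ht₁₀ one_pos,
    fun i => f ⟨i.1, lt_of_lt_of_le i.2 hkm⟩, ?_, ?_, ?_, ?_, ?_⟩
  · exact fun i => eigen_continuous hf _
  · exact fun i => eigen_bounded hf _
  · exact fun i => hf.2.1 _
  · exact fun i => eigen_integrable hf _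
  intro t ht htle g hgm hgb hgi hsupp horth
  have ht10 : t ≤ t₁₀ := htle.trans (min_le_left _ _)
  have ht1 : t ≤ 1 := htle.trans (min_le_right _ _)
  -- the split `g = F + r`, `c_j = ⟨g, f_j⟩`
  set c : Fin (m + 1) → ℝ := fun j => ∫ y, g y * f j y with hc
  set F : ZM → ℝ := fun x => ∑ j, c j * f j x with hF
  set r : ZM → ℝ := fun x => g x - ∑ j, c j * f j x with hr
  have hgFr : (fun x => F x + r x) = g := by
    funext x
    simp only [hF, hr]
    ring
  -- plumbing for `F`, `g`, `r`
  have hFm : Measurable F := span_measurable hf c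
  have hFb : ∃ M : ℝ, ∀ x, |F x| ≤ M := span_bounded hf c
  have hFw : Integrable (fun x => (1 + ‖x‖ ^ 4) * F x ^ 2) := hW m f hf c
  have hgw : Integrable (fun x => (1 + ‖x‖ ^ 4) * g x ^ 2) := hB g hgm hgb _ hsupp
  have hrm : Measurable r := hgm.sub (span_measurable hf c)
  have hrb : ∃ M : ℝ, ∀ x, |r x| ≤ M := by
    obtain ⟨B, hB⟩ := hgb
    obtain ⟨M', hM'⟩ := hFb
    exact ⟨B + M', fun x => (abs_sub _ _).trans (add_le_add (hB x) (hM' x))⟩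
  have hrw : Integrable (fun x => (1 + ‖x‖ ^ 4) * r x ^ 2) := weight_integrable_sub hgm hFm hgw hFw
  have hr2 : Integrable (fun x => r x ^ 2) := sq_integrable_of_weight hrm hrw
  have hg2 : Integrable (fun x => g x ^ 2) := sq_integrable_of_weight hgm hgw
  have hri : IsGaugeInv r := fun R hR x => by
    simp only [hr, hgi R hR x, hf.2.1 _ R hR x]
  have hrorth : ∀ j, ∫ x, r x * f j x = 0 := fun j => (hπ m f hf g hgm hgb).1 j
  -- integrability of `g` (ball support), `F` (span) and `r` (slotsA)
  have hgI : Integrable g := by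
    obtain ⟨B, hB'⟩ := hgb
    exact integrable_of_bounded_of_support hgm hB' hsupp
  have hFi : Integrable F := by
    rw [hF]
    exact integrable_finsetSum _ fun j _ => (eigen_integrable hf j).const_mul (c j)
  have hrI : Integrable r := by
    simpa only [hr, hF, Pi.sub_def] using hgI.sub hFi
  -- the two masses `A = ‖F‖² = Σ c_j²`, `Bm = ‖r‖²`
  set A : ℝ := ∑ j, c j ^ 2 with hA
  set Bm : ℝ := ∫ x, r x ^ 2 with hBm
  have hA0 : 0 ≤ A := Finset.sum_nonneg fun j _ => sq_nonneg (c j)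
  have hBm0 : 0 ≤ Bm := integral_nonneg fun x => sq_nonneg (r x)
  have hsplit : ∫ x, g x ^ 2 = A + Bm := (hπ m f hf g hgm hgb).2 hg2
  -- the `k` constraints kill the low coefficients, so `Σ c_j² E_j ≥ E_k Σ c_j²`
  have hc0 : ∀ j : Fin (m + 1), (j : ℕ) < k → c j = 0 := by
    intro j hj
    have h := horth ⟨j.1, hj⟩
    simpa [hc] using h
  have hsumE : physLevel (k + 1) * A ≤ ∑ j, c j ^ 2 * physLevel ((j : ℕ) + 1) := by
    rw [hA, Finset.mul_sum]
    refine Finset.sum_le_sum fun j _ => ?_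
    by_cases hj : (j : ℕ) < k
    · simp [hc0 j hj]
    · have hle : physLevel (k + 1) ≤ physLevel ((j : ℕ) + 1) := physLevel_mono (by omega) (by omega)
      nlinarith [hle, sq_nonneg (c j)]
  -- III.8 on the span
  have h8' : physLevel (k + 1) * A - max C₈ 0 * t * A ≤ kacForm t F := by
    have h := h8 t ht c
    rw [← hA] at h
    have hmax : C₈ * t * A ≤ max C₈ 0 * t * A := by
      have h1 : C₈ ≤ max C₈ 0 := le_max_left _ _
      nlinarith [mul_nonneg ht.le hA0]
    rw [hF]
    linarith
  -- III.9 on the cross term, then the absorption `2C₉√t√A√Bm ≤ Bm + C₉² t A`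
  have h9' : -(Bm + C₉ ^ 2 * t * A) ≤ 2 * kacBil t F r := by
    have h := h9 t ht ht1 c r hrm hrb hrI hr2 hrorth
    rw [← hA, ← hBm] at h
    have habs := (abs_le.1 h).1
    have hy : (C₉ * (Real.sqrt t * Real.sqrt A)) ^ 2 = C₉ ^ 2 * (t * A) := by
      rw [mul_pow, mul_pow, Real.sq_sqrt ht.le, Real.sq_sqrt hA0]
    have hx : Real.sqrt Bm ^ 2 = Bm := Real.sq_sqrt hBm0
    rw [hF]
    nlinarith [sq_nonneg (Real.sqrt Bm - C₉ * (Real.sqrt t * Real.sqrt A)), hx, hy, habs]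
  -- III.10 on the high modes, with the slack `D = t·M·A` of A5
  have h10' : (physLevel (k + 1) + 1) * Bm - A₁₀ * (t * (M * A)) ≤ kacForm t r := by
    have hD : 0 ≤ t * (M * A) := mul_nonneg ht.le (mul_nonneg hM0 hA0)
    have hmom' := hmom t ht κ hκ c g hgm hgb hsupp
    exact h10 t ht ht10 r hrm hrb hri hrI hrw hrorth ⟨c, g, κ / Real.sqrt t, hgm, hgb, hgi, hsupp, fun x => rfl⟩
      (t * (M * A)) hD hmom'
  -- expansion `kac(g) = kac(F) + 2 kacBil(F,r) + kac(r)` and conclusion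
  have hexp : kacForm t g = kacForm t F + 2 * kacBil t F r + kacForm t r := by
    rw [← hgFr]
    exact hadd t ht F r hFm hrm hFb hrb hFi hrI hFw hrw
  rw [hsplit, hexp]
  have hAM : 0 ≤ A₁₀ * M := mul_nonneg hA₁₀ hM0
  have hC0 : 0 ≤ max C₈ 0 + C₉ ^ 2 + A₁₀ * M := by nlinarith [le_max_right C₈ 0, sq_nonneg C₉, hAM]
  nlinarith [mul_nonneg (mul_nonneg hC0 ht.le) hBm0, h8', h9', h10', hsumE, hAM]

end KacFlatAssembly

end Summit.QuantumFields.YangMills.Theorems.FemtoTransferGap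

end
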